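import Literature.NumberTheory.GaloisRepresentations.PicardFrobeniusDegreeFunctionEtale
import Literature.NumberTheory.GaloisRepresentations.PstWeilDeligneDualDeRham
import Literature.NumberTheory.GaloisRepresentations.PicardCurveGaloisRepDeRham
import Literature.NumberTheory.EllipticCurves.HasseWeilAbelian
import HarnessLib

/-!
# The `λ`-adic representation of a Picard curve is de Rham at `λ` GIVEN the comparison theorem for
# its Tate module (reduction of `picardCurve_exists_lambdaAdicRep_isDeRhamFramed` to named inputs)

Topic `Literature/NumberTheory/GaloisRepresentations`; **proof file** (theorems only: no definition, no
named fact).  Toward the named fact `picardCurve_exists_lambdaAdicRep_isDeRhamFramed`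
(`PicardCurveGaloisRepDeRham`; Upton 2009 + Faltings 1989).

The witness of `picardCurve_exists_lambdaAdicRep` built in the tree (`PicardLambdaAdicRep`,
`PicardLambdaAdicRepChebotarev`) is `ρ = (ρ₁)^∨`, `ρ₁ = picardRho1 hcard b u hu : Γ_K → GL₃(ℚ̄₃)` the Tate
module `T = T₃ J(C_f) ≅ ℤ₃[ω]³` (basis `b`) pushed along `ℤ₃[ω] → ℚ̄₃`, `ω ↦ u`.  This file proves the
`p`-adic Hodge theoretic GLUE between the de Rham clause of the strengthened fact and the geometric
object `V₃ J(C_f) = ℚ₃ ⊗ T₃ J(C_f)` (the tree's `RationalTateModule`, `rationalTateGaloisRepOf`):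

* `PadicEisenstein.lift_mem_adjoin`, `finrank_adjoin_eq_two_of_sq_add_self_add_one` — the entries of
  `ρ₁` lie in the quadratic field `E = ℚ₃(u) ⊆ ℚ̄₃` (`u² + u + 1 = 0`; `X² + X + 1` is irreducible over
  `ℚ₃`, `PadicEisenstein.irreducible_map_eisensteinCubicPoly`);
* `exists_baseChange_eq_picardRho1` — so `ρ₁ = rE ⊗_E ℚ̄₃` for a framed `rE : Γ_K → GL₃(E)` (the
  corestriction, `FramedRep.exists_baseChange_eq`), a finite model of `ρ₁` with frame `1`;
* `exists_coordinateMap`, `coordinateMap_smul` — the `ℤ₃`-linear coordinate map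
  `θ : T → E³`, `θ(t)_j = σ_u(b^*_j(t))`, intertwines the Galois actions: `θ(g t) = rE(g) θ(t)`;
* `exists_linearEquiv_rationalTateModule` — its `ℚ₃`-linear extension `Φ : V₃ J(C_f) = ℚ₃ ⊗_{ℤ₃} T ≃ E³`
  is a `Γ_K`-equivariant isomorphism onto the `ℚ₃`-linear representation underlying `rE`
  (surjective onto a space of the same dimension `6`);
* **`isDeRhamWith_toLocal_picardRho1_of_isAdmissible`** — hence, for every place `v` and every
  period-ring datum `𝔅` on `K_v`: if `V₃ J(C_f)|_{Γ_{K_v}}` is `𝔅`-admissible then `ρ₁|_{Γ_{K_v}}` is de Rham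
  for `𝔅` in the framed sense (`FramedRep.IsDeRhamWith`: model `rE|_{Γ_{K_v}}`, admissibility transported
  by `PeriodRingData.isAdmissible_iff_of_equiv`), and so is `ρ = ρ₁^∨` (`PstWeilDeligneDualDeRham`);
* `picard_continuous_rationalTateRepresentation` — `V₃ J(C_f)` IS a continuous `ℚ₃`-linear representation
  of `Γ_K` for every Picard quartic over a number field `K ⊇ ℚ(ω)` (no torsion count needed), so that the
  comparison hypothesis below is a statement about the tree's own object
  `rationalTateGaloisRepOf (Pic(C_{f,K̄})) 3 _ |>.toLocal v`;
* `picard_exists_framedGaloisRep_isDeRhamFramed_of_finrank_eq_six` — the witness `ρ = ρ₁^∨` of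
  `picard_exists_framedGaloisRep_of_finrank_eq_six` (`PicardLambdaAdicRepChebotarev`) with the de Rham clause;
* **`picardCurve_exists_lambdaAdicRep_isDeRhamFramed_of_goodReduction_lefschetz_of_isDeRham`** — the
  strengthened fact from: the good-reduction datum `hX2` (Serre–Tate), the twisted Lefschetz formula `hX3`
  (Weil; or Weil's untwisted trace formula, `…_of_goodReduction_weil_of_isDeRham`) — the inputs of
  `picardCurve_exists_lambdaAdicRep_of_goodReduction_lefschetz` — and (`hdR`) the de Rham comparison
  theorem for the Tate module of the Picard curves at the places above `3`: for every number field
  `K ⊇ ℚ(ω)` and `v ∣ 3`, `V₃ J(C_f)|_{Γ_{K_v}}` is `B_dR`-admissible for Fontaine's pinned datum (Faltings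
  1989, `C_dR` for `H¹`; for abelian varieties Fontaine–Messing 1987 / Faltings), stated on the tree's own
  object and kept an explicit hypothesis (stated for all `K ⊇ ℚ(ω)`, like the inputs of the tree's
  conditional theorems, so that no `ℤ`-algebra diamond on `CyclotomicField 3 ℚ` enters it).

* `superelliptic_weil_of_degdet`, `superelliptic_degdet_of_degreeFunction_etale` — the finite-field inputs of
  the tree's doors as standalone implications (the inline arguments of `PicardFrobeniusDegDet`,
  `PicardFrobeniusDegreeFunctionEtale`): degree function with étale kernel counts `hδ` ⟹ `deg = det` `hD` ⟹
  Weil's trace formula `hW`;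
* **`picardCurve_exists_lambdaAdicRep_isDeRhamFramed_of_lefschetz_of_isDeRham`**, `…_of_weil_of_isDeRham`,
  `…_of_degdet_of_isDeRham`, **`…_of_degreeFunction_etale_of_isDeRham`** — the same doors WITHOUT the
  good-reduction hypothesis, Deuring's reduction datum being a theorem (public forms
  `picardRho1_isUnramifiedAt_deuringDatum`, `trace_dual_picardRho1_frob_inv_of_card_deuringDatum`,
  `picard_finrank_tateModule_eq_six_deuringDatum` of `PicardGoodReductionDeuring`), down to the deepest input
  `hδ` of the tree's `picardCurve_exists_lambdaAdicRep_of_degreeFunction_etale`: the strengthened fact is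
  reduced to EXACTLY `hδ` (the degree function of the Jacobian of `y^p = f(x)` over finite fields, shared with
  the original fact) and `hdR` (the de Rham comparison theorem for the Tate modules of the Picard curves).

What is NOT here: the two inputs themselves — `hδ` is the theory of the Jacobian as an abelian variety over a
finite field (Mumford §19 Thm. 2, Thm. 4, §21: a multiplicative degree function on `ℤ[φ]`, polynomial on monic
polynomials, with `#ker F(φ) = |deg F(φ)|_ℓ⁻¹` on `ℓ`-primary torsion for étale `F(φ)` and `deg(φ^r - 1) = #Pic⁰(C_Ω)^{φ^r}`),
and `hdR` is the comparison theorem `C_dR` of `p`-adic Hodge theory for the curve `C_f` (equivalently for its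
Jacobian; Faltings 1989, Ch. VIII Thm. 8.1; Tsuji, ICM 1998, Cor. 2.2.3), for which the tree has Fontaine's
`B_dR(K_v)` (`PAdicHodge.BdRPeriodRingData`, Ax–Sen–Tate) but no comparison with any geometric cohomology.

## References
* [Upton2009] M. Upton, *Galois representations attached to Picard curves*, J. Algebra 322 (2009), Thm. 2.1, §4.
* [Faltings1989Crystalline] G. Faltings, *Crystalline cohomology and p-adic Galois representations* (1989), §5.
* [FontaineAsterisque223III] J.-M. Fontaine, Astérisque 223 (1994), Exp. III, §1.5, Prop. 1.5.2, §3.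
* [BuzzardGeeLMS2014] K. Buzzard, T. Gee, LMS Lecture Note Ser. 414 (2014), §2.2 (coefficient fields).
* [Tsuji1998ICM] T. Tsuji, *p-adic Hodge theory in the semi-stable reduction case*, Doc. Math. Extra Vol. ICM 1998 II,
  207–216, Cor. 2.2.3 (p. 209: every `H^q_ét(X_{K̄}, ℚ_p)`, `X/K` proper, is potentially semistable, hence de Rham).
* [MumfordAV1970] D. Mumford, *Abelian Varieties* (1970), §19 Thm. 2, Thm. 4; §21.
* [Milne1986AbelianVarieties] [Milne1986JacobianVarieties] J. S. Milne, in Cornell–Silverman (1986), AV §12, §19; JV §11.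
* [Deuring1942Reduktion] M. Deuring, *Reduktion algebraischer Funktionenkörper nach Primdivisoren des Konstantenkörpers*,
  Math. Z. 47 (1942), §4.
-/

noncomputable section

open Polynomial
open scoped TensorProduct Matrix IntermediateField

namespace Literature.NumberTheory.GaloisRepresentations

open Literature.NumberTheory.EllipticCurves Literature.NumberTheory.Automorphic Field IsDedekindDomain
open scoped NumberField Pointwise

/-! ### The quadratic coefficient field `ℚ₃(u) ⊆ ℚ̄₃` -/

section CoefficientField

variable (u : PadicAlgCl 3) (hu : u ^ 2 + u + 1 = 0)

/-- `u` is integral over `ℚ₃` (it is algebraic, `ℚ̄₃/ℚ₃` being algebraic). [folklore] -/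
theorem isIntegral_padicAlgCl (x : PadicAlgCl 3) : IsIntegral ℚ_[3] x :=
  (Algebra.IsAlgebraic.isAlgebraic x).isIntegral

include hu in
/-- The minimal polynomial of a primitive cube root of unity of `ℚ̄₃` over `ℚ₃` is `X² + X + 1`
(irreducible over `ℚ₃`: `PadicEisenstein.irreducible_map_eisensteinCubicPoly`). [folklore] -/
theorem minpoly_eq_of_sq_add_self_add_one :
    minpoly ℚ_[3] u = eisensteinCubicPoly.map (algebraMap ℤ_[3] ℚ_[3]) := by
  symm
  refine minpoly.eq_of_irreducible_of_monic PadicEisenstein.irreducible_map_eisensteinCubicPoly ?_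
    (monic_eisensteinCubicPoly.map _)
  rw [Polynomial.aeval_map_algebraMap, PadicEisenstein.aeval_eisensteinCubicPoly, hu]

include hu in
/-- `[ℚ₃(u) : ℚ₃] = 2`. [folklore] -/
theorem finrank_adjoin_eq_two_of_sq_add_self_add_one : Module.finrank ℚ_[3] ℚ_[3]⟮u⟯ = 2 := by
  rw [IntermediateField.adjoin.finrank (isIntegral_padicAlgCl u), minpoly_eq_of_sq_add_self_add_one u hu,
    monic_eisensteinCubicPoly.natDegree_map, natDegree_eisensteinCubicPoly]

/-- `ℚ₃(u)/ℚ₃` is finite. [folklore] -/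
theorem finiteDimensional_adjoin_padicAlgCl : FiniteDimensional ℚ_[3] ℚ_[3]⟮u⟯ :=
  IntermediateField.adjoin.finiteDimensional (isIntegral_padicAlgCl u)

/-- The embedding `ℤ₃[ω] → ℚ̄₃`, `ω ↦ u`, lands in `ℚ₃(u)`. [folklore] -/
theorem PadicEisenstein.lift_mem_adjoin (z : PadicEisenstein) : PadicEisenstein.lift u hu z ∈ ℚ_[3]⟮u⟯ := by
  obtain ⟨a, c, rfl⟩ := PadicEisenstein.exists_eq_add_mul_omega z
  rw [PadicEisenstein.lift_add_mul_omega, IsScalarTower.algebraMap_apply ℤ_[3] ℚ_[3] (PadicAlgCl 3),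
    IsScalarTower.algebraMap_apply ℤ_[3] ℚ_[3] (PadicAlgCl 3)]
  exact add_mem (IntermediateField.algebraMap_mem _ _)
    (mul_mem (IntermediateField.algebraMap_mem _ _) (IntermediateField.mem_adjoin_simple_self ℚ_[3] u))

end CoefficientField

/-! ### The finite model `rE : Γ_K → GL₃(ℚ₃(u))` of `ρ₁` and the coordinate map `θ : T → ℚ₃(u)³` -/

section PicardModel

variable (K : Type) [Field K] [CharZero K] [IsCyclotomicExtension {3} ℚ K]
variable (f : ℤ[X]) [hf4 : Fact (f.natDegree = 4)] [hfs : Fact (f.map (Int.castRingHom ℚ)).Separable]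

attribute [local instance] fact_irreducible_picard_inst picardEisensteinModule picard_isScalarTower_inst
  picard_smulCommClass_inst

variable {K f}

variable (hcard : ∀ n, Nat.card (AddSubgroup.torsionBy (GeomPic K 3 (f.map (algebraMap ℤ K))) (3 ^ n : ℕ)) = 3 ^ (2 * 3 * n))
  (b : Module.Basis (Fin 3) PadicEisenstein (TateModule (GeomPic K 3 (f.map (algebraMap ℤ K))) 3))
  (u : PadicAlgCl 3) (hu : u ^ 2 + u + 1 = 0)

/-- **The corestriction of `ρ₁` to `GL₃(ℚ₃(u))`**: all entries of `ρ₁(g) = σ_u(ρ_O(g))` and of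
`ρ₁(g)⁻¹ = ρ₁(g⁻¹)` lie in `ℚ₃(u)`, so `ρ₁` is the extension of scalars of a framed representation `rE`
over the finite extension `ℚ₃(u)` of `ℚ₃` (`FramedRep.exists_baseChange_eq`) — a finite model of `ρ₁`
with frame `1`. [cite: BuzzardGeeLMS2014, §2.2] -/
theorem exists_baseChange_eq_picardRho1 :
    ∃ rE : FramedGaloisRep K (ℚ_[3]⟮u⟯ : IntermediateField ℚ_[3] (PadicAlgCl 3)) 3,
      rE.baseChange (algebraMap ℚ_[3]⟮u⟯ (PadicAlgCl 3)) continuous_subtype_val = picardRho1 hcard b u hu :=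
  FramedRep.exists_baseChange_eq (picardRho1 hcard b u hu) ℚ_[3]⟮u⟯ fun g i j =>
    ⟨PadicEisenstein.lift_mem_adjoin u hu _, by
      rw [← map_inv]
      exact PadicEisenstein.lift_mem_adjoin u hu _⟩

/-- Entries of the model: `rE(g)_{ij} = σ_u(ρ_O(g)_{ij})` in `ℚ̄₃`. [folklore] -/
theorem coe_apply_of_baseChange_eq_picardRho1
    {rE : FramedGaloisRep K (ℚ_[3]⟮u⟯ : IntermediateField ℚ_[3] (PadicAlgCl 3)) 3}
    (hrE : rE.baseChange (algebraMap ℚ_[3]⟮u⟯ (PadicAlgCl 3)) continuous_subtype_val = picardRho1 hcard b u hu)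
    (g : absoluteGaloisGroup K) (i j : Fin 3) :
    (((rE g : GL (Fin 3) ℚ_[3]⟮u⟯) : Matrix (Fin 3) (Fin 3) ℚ_[3]⟮u⟯) i j : PadicAlgCl 3) =
      PadicEisenstein.lift u hu
        (((picardMatrixRepO b g : GL (Fin 3) PadicEisenstein) : Matrix (Fin 3) (Fin 3) PadicEisenstein) i j) := by
  rw [← picardRho1_apply_coe hcard b u hu g i j, ← hrE, FramedRep.coe_baseChange_apply, Matrix.map_apply]
  rfl

/-- **The coordinate map `θ : T₃ J(C_f) → ℚ₃(u)³`, `θ(t)_j = σ_u(b^*_j(t))`** (the `b`-coordinates pushed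
along `ω ↦ u`), a `ℤ₃`-linear map (stated as an existence theorem). [folklore] -/
theorem exists_coordinateMap :
    ∃ θ : TateModule (GeomPic K 3 (f.map (algebraMap ℤ K))) 3 →ₗ[ℤ_[3]]
        (Fin 3 → (ℚ_[3]⟮u⟯ : IntermediateField ℚ_[3] (PadicAlgCl 3))),
      ∀ t j, (θ t j : PadicAlgCl 3) = PadicEisenstein.lift u hu (b.repr t j) := by
  refine ⟨{ toFun := fun t j => ⟨PadicEisenstein.lift u hu (b.repr t j), PadicEisenstein.lift_mem_adjoin u hu _⟩
            map_add' := fun s t => funext fun j => Subtype.ext ?_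
            map_smul' := fun a t => funext fun j => Subtype.ext ?_ }, fun t j => rfl⟩
  · change PadicEisenstein.lift u hu (b.repr (s + t) j) =
      PadicEisenstein.lift u hu (b.repr s j) + PadicEisenstein.lift u hu (b.repr t j)
    rw [map_add, Finsupp.add_apply, map_add]
  · change PadicEisenstein.lift u hu (b.repr (a • t) j) =
      ((a • fun j => (⟨PadicEisenstein.lift u hu (b.repr t j), PadicEisenstein.lift_mem_adjoin u hu _⟩ :
        (ℚ_[3]⟮u⟯ : IntermediateField ℚ_[3] (PadicAlgCl 3)))) j : PadicAlgCl 3)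
    rw [Pi.smul_apply, IntermediateField.coe_smul, ← algebraMap_smul PadicEisenstein a t, LinearEquiv.map_smul,
      Finsupp.smul_apply, smul_eq_mul, map_mul, PadicEisenstein.lift_algebraMap, Algebra.smul_def]

/-- **The coordinate map intertwines the Galois actions**: `θ(g • t) = rE(g) · θ(t)` — in `ℚ̄₃` both sides
have `j`-th coordinate `σ_u` of `(ρ_O(g) · b^*(t))_j = b^*_j(g • t)` (`LinearMap.toMatrix_mulVec_repr`).
[folklore] -/
theorem coordinateMap_smul
    {rE : FramedGaloisRep K (ℚ_[3]⟮u⟯ : IntermediateField ℚ_[3] (PadicAlgCl 3)) 3}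
    (hrE : rE.baseChange (algebraMap ℚ_[3]⟮u⟯ (PadicAlgCl 3)) continuous_subtype_val = picardRho1 hcard b u hu)
    {θ : TateModule (GeomPic K 3 (f.map (algebraMap ℤ K))) 3 →ₗ[ℤ_[3]]
        (Fin 3 → (ℚ_[3]⟮u⟯ : IntermediateField ℚ_[3] (PadicAlgCl 3)))}
    (hθ : ∀ t j, (θ t j : PadicAlgCl 3) = PadicEisenstein.lift u hu (b.repr t j))
    (g : absoluteGaloisGroup K) (t : TateModule (GeomPic K 3 (f.map (algebraMap ℤ K))) 3) :
    θ (g • t) = ((rE g : GL (Fin 3) ℚ_[3]⟮u⟯) : Matrix (Fin 3) (Fin 3) ℚ_[3]⟮u⟯) *ᵥ θ t := by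
  funext j
  apply Subtype.ext
  have hmat : ((picardMatrixRepO b g : GL (Fin 3) PadicEisenstein) : Matrix (Fin 3) (Fin 3) PadicEisenstein) =
      LinearMap.toMatrix b b
        (DistribMulAction.toModuleEnd PadicEisenstein (TateModule (GeomPic K 3 (f.map (algebraMap ℤ K))) 3) g) := by
    ext i k
    rw [picardMatrixRepO_apply, LinearMap.toMatrix_apply]
    rfl
  have hrepr : b.repr (g • t) j =
      ∑ i, ((picardMatrixRepO b g : GL (Fin 3) PadicEisenstein) : Matrix (Fin 3) (Fin 3) PadicEisenstein) j i *
        b.repr t i := by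
    have h := LinearMap.toMatrix_mulVec_repr b b
      (DistribMulAction.toModuleEnd PadicEisenstein (TateModule (GeomPic K 3 (f.map (algebraMap ℤ K))) 3) g) t
    rw [← hmat] at h
    have hj := congrFun h j
    rw [Matrix.mulVec, dotProduct] at hj
    exact hj.symm
  rw [hθ, hrepr, map_sum, Matrix.mulVec, dotProduct, AddSubmonoidClass.coe_finsetSum]
  refine Finset.sum_congr rfl fun i _ => ?_
  rw [map_mul, MulMemClass.coe_mul, hθ, coe_apply_of_baseChange_eq_picardRho1 hcard b u hu hrE]


/-- **The coordinate map spans `ℚ₃(u)³` over `ℚ₃`**: `θ(ωⁱ • b_j) = (0, …, uⁱ, …, 0)` (`uⁱ` at place `j`),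
and `1, u, …` generate `ℚ₃(u)` over `ℚ₃` (power basis of `ℚ₃⟮u⟯`). [folklore] -/
theorem span_range_coordinateMap_eq_top
    {θ : TateModule (GeomPic K 3 (f.map (algebraMap ℤ K))) 3 →ₗ[ℤ_[3]]
        (Fin 3 → (ℚ_[3]⟮u⟯ : IntermediateField ℚ_[3] (PadicAlgCl 3)))}
    (hθ : ∀ t j, (θ t j : PadicAlgCl 3) = PadicEisenstein.lift u hu (b.repr t j)) :
    Submodule.span ℚ_[3] (Set.range θ) = ⊤ := by
  classical
  set pb := IntermediateField.adjoin.powerBasis (isIntegral_padicAlgCl u) with hpb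
  have hgen : (pb.gen : PadicAlgCl 3) = u := by
    rw [hpb, IntermediateField.adjoin.powerBasis_gen, IntermediateField.AdjoinSimple.coe_gen]
  -- the values `θ(ωⁱ • b j)`
  have hθb : ∀ (i : ℕ) (j : Fin 3),
      θ (PadicEisenstein.omega ^ i • b j) = Pi.single j (pb.gen ^ i) := by
    intro i j
    funext j'
    apply Subtype.ext
    rw [hθ, LinearEquiv.map_smul, Finsupp.smul_apply, Module.Basis.repr_self, Finsupp.single_apply,
      Pi.single_apply, smul_eq_mul]
    by_cases h : j = j'
    · subst h
      rw [if_pos rfl, if_pos rfl, mul_one, map_pow, PadicEisenstein.lift_omega, SubmonoidClass.coe_pow, hgen]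
    · rw [if_neg h, if_neg (Ne.symm h), mul_zero, map_zero, ZeroMemClass.coe_zero]
  rw [eq_top_iff]
  rintro y -
  rw [← Finset.univ_sum_single y]
  refine Submodule.sum_mem _ fun j _ => ?_
  have h1 : y j = ∑ i, pb.basis.repr (y j) i • pb.gen ^ (i : ℕ) := by
    conv_lhs => rw [← pb.basis.sum_repr (y j)]
    simp only [PowerBasis.coe_basis]
  have hy : (Pi.single j (y j) : Fin 3 → (ℚ_[3]⟮u⟯ : IntermediateField ℚ_[3] (PadicAlgCl 3))) =
      ∑ i, pb.basis.repr (y j) i •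
        (Pi.single j (pb.gen ^ (i : ℕ)) : Fin 3 → (ℚ_[3]⟮u⟯ : IntermediateField ℚ_[3] (PadicAlgCl 3))) := by
    conv_lhs => rw [h1]
    change LinearMap.single ℚ_[3] (fun _ : Fin 3 => (ℚ_[3]⟮u⟯ : IntermediateField ℚ_[3] (PadicAlgCl 3))) j
      (∑ i, pb.basis.repr (y j) i • pb.gen ^ (i : ℕ)) = _
    rw [map_sum]
    refine Finset.sum_congr rfl fun i _ => ?_
    rw [map_smul]
    rfl
  rw [hy]
  exact Submodule.sum_mem _ fun i _ =>
    Submodule.smul_mem _ _ (Submodule.subset_span ⟨PadicEisenstein.omega ^ (i : ℕ) • b j, hθb i j⟩)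

/-- **The comparison isomorphism `Φ : V₃ J(C_f) ≃ ℚ₃(u)³`**, `Γ_K`-equivariant onto the `ℚ₃`-linear
representation `x ↦ rE(g) x` underlying the model `rE`: the `ℚ₃`-linear extension of the coordinate map
`θ` to `V₃ = ℚ₃ ⊗_{ℤ₃} T₃` (Mathlib `LinearMap.liftBaseChange`) is surjective
(`span_range_coordinateMap_eq_top`) between spaces of the same dimension `6 = 3 · [ℚ₃(u) : ℚ₃]`
(`RationalTateModule.finrank_eq_of_card_torsionBy`, `finrank_adjoin_eq_two_of_sq_add_self_add_one`), and intertwines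
`1 ⊗ g` with `rE(g)` (`coordinateMap_smul`). [cite: Upton2009, §2] -/
theorem exists_linearEquiv_rationalTateModule
    {rE : FramedGaloisRep K (ℚ_[3]⟮u⟯ : IntermediateField ℚ_[3] (PadicAlgCl 3)) 3}
    (hrE : rE.baseChange (algebraMap ℚ_[3]⟮u⟯ (PadicAlgCl 3)) continuous_subtype_val = picardRho1 hcard b u hu) :
    ∃ Φ : RationalTateModule (GeomPic K 3 (f.map (algebraMap ℤ K))) 3 ≃ₗ[ℚ_[3]]
        (Fin 3 → (ℚ_[3]⟮u⟯ : IntermediateField ℚ_[3] (PadicAlgCl 3))),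
      ∀ (g : absoluteGaloisGroup K) (x : RationalTateModule (GeomPic K 3 (f.map (algebraMap ℤ K))) 3),
        Φ (rationalTateRepresentation (absoluteGaloisGroup K) (GeomPic K 3 (f.map (algebraMap ℤ K))) 3 g x) =
          ((rE g : GL (Fin 3) ℚ_[3]⟮u⟯) : Matrix (Fin 3) (Fin 3) ℚ_[3]⟮u⟯) *ᵥ Φ x := by
  classical
  obtain ⟨θ, hθ⟩ := exists_coordinateMap (K := K) (f := f) b u hu
  haveI := finiteDimensional_adjoin_padicAlgCl u
  haveI := RationalTateModule.finite_of_card_torsionBy_rank hcard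
  -- `Φ₀ = θ ⊗ ℚ₃`
  let Φ₀ : RationalTateModule (GeomPic K 3 (f.map (algebraMap ℤ K))) 3 →ₗ[ℚ_[3]]
      (Fin 3 → (ℚ_[3]⟮u⟯ : IntermediateField ℚ_[3] (PadicAlgCl 3))) :=
    (θ.liftBaseChange ℚ_[3] :
      ℚ_[3] ⊗[ℤ_[3]] TateModule (GeomPic K 3 (f.map (algebraMap ℤ K))) 3 →ₗ[ℚ_[3]]
        (Fin 3 → (ℚ_[3]⟮u⟯ : IntermediateField ℚ_[3] (PadicAlgCl 3))))
  have hΦ₀ : ∀ (c : ℚ_[3]) (t : TateModule (GeomPic K 3 (f.map (algebraMap ℤ K))) 3),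
      Φ₀ ((c ⊗ₜ[ℤ_[3]] t : ℚ_[3] ⊗[ℤ_[3]] TateModule (GeomPic K 3 (f.map (algebraMap ℤ K))) 3) :
        RationalTateModule (GeomPic K 3 (f.map (algebraMap ℤ K))) 3) = c • θ t :=
    fun c t => LinearMap.liftBaseChange_tmul ℚ_[3] θ c t
  -- surjective, between spaces of dimension `6`
  have hsurj : Function.Surjective Φ₀ := by
    rw [← LinearMap.range_eq_top]
    have hrange : LinearMap.range Φ₀ = Submodule.span ℚ_[3] (Set.range θ) :=
      LinearMap.range_liftBaseChange ℚ_[3] θ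
    rw [hrange, span_range_coordinateMap_eq_top b u hu hθ]
  have hdim : Module.finrank ℚ_[3] (RationalTateModule (GeomPic K 3 (f.map (algebraMap ℤ K))) 3) =
      Module.finrank ℚ_[3] (Fin 3 → (ℚ_[3]⟮u⟯ : IntermediateField ℚ_[3] (PadicAlgCl 3))) := by
    rw [RationalTateModule.finrank_eq_of_card_torsionBy hcard, Module.finrank_pi_fintype ℚ_[3],
      Finset.sum_const, Finset.card_univ, Fintype.card_fin, finrank_adjoin_eq_two_of_sq_add_self_add_one u hu, smul_eq_mul]
  have hinj : Function.Injective Φ₀ :=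
    (LinearMap.injective_iff_surjective_of_finrank_eq_finrank hdim).2 hsurj
  -- equivariance, checked on the tensor product `ℚ₃ ⊗ T₃` (`V₃(g) = 1 ⊗ T₃(g)`)
  have key : ∀ (g : absoluteGaloisGroup K) (x : ℚ_[3] ⊗[ℤ_[3]] TateModule (GeomPic K 3 (f.map (algebraMap ℤ K))) 3),
      θ.liftBaseChange ℚ_[3]
          ((tateRepresentation (absoluteGaloisGroup K) (GeomPic K 3 (f.map (algebraMap ℤ K))) 3 g).baseChange ℚ_[3] x) =
        ((rE g : GL (Fin 3) ℚ_[3]⟮u⟯) : Matrix (Fin 3) (Fin 3) ℚ_[3]⟮u⟯) *ᵥ θ.liftBaseChange ℚ_[3] x := by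
    intro g x
    induction x using TensorProduct.induction_on with
    | zero => rw [map_zero, map_zero, Matrix.mulVec_zero]
    | tmul c t =>
      rw [LinearMap.baseChange_tmul, LinearMap.liftBaseChange_tmul, LinearMap.liftBaseChange_tmul,
        Matrix.mulVec_smul]
      exact congrArg (c • ·) (coordinateMap_smul hcard b u hu hrE hθ g t)
    | add x y hx hy => rw [map_add, map_add, hx, hy, map_add, Matrix.mulVec_add]
  exact ⟨LinearEquiv.ofBijective Φ₀ ⟨hinj, hsurj⟩, fun g x => key g x⟩

end PicardModel

/-! ### The glue: `V₃ J(C_f)|_{Γ_{K_v}}` admissible ⟹ `ρ₁|_{Γ_{K_v}}` and `ρ₁^∨|_{Γ_{K_v}}` de Rham -/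

section PicardLocal

variable (K : Type) [Field K] [NumberField K] [IsCyclotomicExtension {3} ℚ K]

/-- **`V₃ J(C_f)` is a continuous representation of `Γ_K`** for every Picard quartic over a number field
`K ⊇ ℚ(ω)` (no torsion count needed): `Pic(C_{f,K̄})` is a discrete `Γ_K`-module
(`picard_continuousSMul_geomPic`) and `T₃ J(C_f)` is finitely generated over `ℤ₃`
(`picard_finite_tateModule_inst`), so the tree's `continuous_rationalTateRepresentation` applies.
[cite: SerreTate1968GoodReduction, §1] -/
theorem picard_continuous_rationalTateRepresentation (f : ℤ[X]) (h4 : f.natDegree = 4)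
    (hsep : (f.map (Int.castRingHom ℚ)).Separable) :
    haveI := fact_irreducible_superellipticPoly_picard K h4 hsep
    Continuous fun x : absoluteGaloisGroup K × RationalTateModule (GeomPic K 3 (f.map (algebraMap ℤ K))) 3 =>
      rationalTateRepresentation (absoluteGaloisGroup K) (GeomPic K 3 (f.map (algebraMap ℤ K))) 3 x.1 x.2 := by
  haveI : Fact (f.natDegree = 4) := ⟨h4⟩
  haveI : Fact (f.map (Int.castRingHom ℚ)).Separable := ⟨hsep⟩
  haveI := fact_irreducible_superellipticPoly_picard K h4 hsep
  haveI := picard_continuousSMul_geomPic K h4 hsep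
  haveI : Module.Finite ℤ_[3] (TateModule (GeomPic K 3 (f.map (algebraMap ℤ K))) 3) :=
    picard_finite_tateModule_inst K f
  exact continuous_rationalTateRepresentation 3

variable (f : ℤ[X]) [hf4 : Fact (f.natDegree = 4)] [hfs : Fact (f.map (Int.castRingHom ℚ)).Separable]

attribute [local instance] fact_irreducible_picard_inst picardEisensteinModule picard_isScalarTower_inst
  picard_smulCommClass_inst

variable {K f}

variable (hcard : ∀ n, Nat.card (AddSubgroup.torsionBy (GeomPic K 3 (f.map (algebraMap ℤ K))) (3 ^ n : ℕ)) = 3 ^ (2 * 3 * n))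
  (b : Module.Basis (Fin 3) PadicEisenstein (TateModule (GeomPic K 3 (f.map (algebraMap ℤ K))) 3))
  (u : PadicAlgCl 3) (hu : u ^ 2 + u + 1 = 0)

-- Mathlib's own global value of `maxSynthPendingDepth` (nested instance problems on `𝔅.B ⊗[P] M`, see the
-- note in `PAdicHodgeProofs`).
set_option maxSynthPendingDepth 3 in
/-- **The glue (Fontaine, Exp. III §1.5 / Prop. 1.5.2, for the Picard curve).**  Let `v` be a finite place
of the number field `K ⊇ ℚ(ω)`, `alg` a `ℚ₃`-structure on `K_v` and `𝔅` a period-ring datum for `Γ_{K_v}`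
(intended: `B_dR(K_v)`).  If the rational Tate module `V₃ J(C_f) = ℚ₃ ⊗ T₃ J(C_f)` restricted to `Γ_{K_v}`
(the tree's `rationalTateGaloisRepOf … |>.toLocal v`) is `𝔅`-admissible, then
`ρ₁|_{Γ_{K_v}} = (picardRho1 hcard b u hu).toLocal v` is de Rham for `(alg, 𝔅)` in the framed sense
`FramedRep.IsDeRhamWith`: its finite model is the corestriction `rE|_{Γ_{K_v}}` over `ℚ₃(u)` with frame `1`
(`exists_baseChange_eq_picardRho1`), whose underlying `ℚ₃`-linear representation is isomorphic to
`V₃ J(C_f)|_{Γ_{K_v}}` (`exists_linearEquiv_rationalTateModule`), and admissibility is an isomorphism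
invariant (`PeriodRingData.isAdmissible_iff_of_equiv`).
[cite: FontaineAsterisque223III, Exp. III §1.5 and Prop. 1.5.2] [cite: BuzzardGeeLMS2014, §2.2] -/
theorem isDeRhamWith_toLocal_picardRho1_of_isAdmissible (v : HeightOneSpectrum (𝓞 K))
    (alg : Algebra ℚ_[3] (v.adicCompletion K))
    (𝔅 : PeriodRingData.{0, 0, 0, 0} (absoluteGaloisGroup (v.adicCompletion K)) ℚ_[3] (v.adicCompletion K))
    (hc : Continuous fun x : absoluteGaloisGroup K × RationalTateModule (GeomPic K 3 (f.map (algebraMap ℤ K))) 3 =>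
      rationalTateRepresentation (absoluteGaloisGroup K) (GeomPic K 3 (f.map (algebraMap ℤ K))) 3 x.1 x.2)
    (h : 𝔅.IsAdmissible ((rationalTateGaloisRepOf (GeomPic K 3 (f.map (algebraMap ℤ K))) 3 hc).toLocal v)) :
    (FramedGaloisRep.toLocal v (picardRho1 hcard b u hu)).IsDeRhamWith alg 𝔅 := by
  obtain ⟨rE, hrE⟩ := exists_baseChange_eq_picardRho1 hcard b u hu
  obtain ⟨Φ, hΦ⟩ := exists_linearEquiv_rationalTateModule hcard b u hu hrE
  refine ⟨ℚ_[3]⟮u⟯, finiteDimensional_adjoin_padicAlgCl u, FramedGaloisRep.toLocal v rE, ⟨1, ?_⟩, ?_⟩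
  · refine ContinuousMonoidHom.ext fun σ => ?_
    rw [FramedRep.conj_apply, one_mul, inv_one, mul_one]
    change (rE.baseChange (algebraMap ℚ_[3]⟮u⟯ (PadicAlgCl 3)) continuous_subtype_val)
        (absGaloisRestrict K (v.adicCompletion K) σ) =
      (picardRho1 hcard b u hu) (absGaloisRestrict K (v.adicCompletion K) σ)
    rw [hrE]
  · letI := alg
    exact (𝔅.isAdmissible_iff_of_equiv _ _ Φ fun σ x => hΦ (absGaloisRestrict K (v.adicCompletion K) σ) x).1 h

/-- **For Fontaine's pinned datum at `v ∣ 3`** (`PAdicHodge.fontainePstAdicCompletion`, the term of the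
fact `picardCurve_exists_lambdaAdicRep_isDeRhamFramed`): if `V₃ J(C_f)|_{Γ_{K_v}}` is `B_dR`-admissible
(de Rham) then `ρ₁|_{Γ_{K_v}}` is de Rham. [cite: FontaineAsterisque223III, Exp. III §1.5 and §3] -/
theorem isDeRhamFramed_toLocal_picardRho1_of_isAdmissible (v : HeightOneSpectrum (𝓞 K))
    (hv : ((3 : ℕ) : 𝓞 K) ∈ v.asIdeal)
    (hc : Continuous fun x : absoluteGaloisGroup K × RationalTateModule (GeomPic K 3 (f.map (algebraMap ℤ K))) 3 =>
      rationalTateRepresentation (absoluteGaloisGroup K) (GeomPic K 3 (f.map (algebraMap ℤ K))) 3 x.1 x.2)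
    (h : letI := (PAdicHodge.fontainePstAdicCompletion v 3 hv).algebra
      (PAdicHodge.fontainePstAdicCompletion v 3 hv).𝔅.IsAdmissible
        ((rationalTateGaloisRepOf (GeomPic K 3 (f.map (algebraMap ℤ K))) 3 hc).toLocal v)) :
    (PAdicHodge.fontainePstAdicCompletion v 3 hv).IsDeRhamFramed
      (FramedGaloisRep.toLocal v (picardRho1 hcard b u hu)) :=
  isDeRhamWith_toLocal_picardRho1_of_isAdmissible hcard b u hu v _ _ hc h

/-- **… and so is the dual `ρ₁^∨|_{Γ_{K_v}}`** — the witness of `picardCurve_exists_lambdaAdicRep` built in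
the tree — by the dual case of Fontaine's Prop. 1.5.2 (`fontainePstAdicCompletion_isDeRhamFramed_dual_toLocal`).
[cite: FontaineAsterisque223III, Exp. III Prop. 1.5.2] -/
theorem isDeRhamFramed_toLocal_dual_picardRho1_of_isAdmissible (v : HeightOneSpectrum (𝓞 K))
    (hv : ((3 : ℕ) : 𝓞 K) ∈ v.asIdeal)
    (hc : Continuous fun x : absoluteGaloisGroup K × RationalTateModule (GeomPic K 3 (f.map (algebraMap ℤ K))) 3 =>
      rationalTateRepresentation (absoluteGaloisGroup K) (GeomPic K 3 (f.map (algebraMap ℤ K))) 3 x.1 x.2)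
    (h : letI := (PAdicHodge.fontainePstAdicCompletion v 3 hv).algebra
      (PAdicHodge.fontainePstAdicCompletion v 3 hv).𝔅.IsAdmissible
        ((rationalTateGaloisRepOf (GeomPic K 3 (f.map (algebraMap ℤ K))) 3 hc).toLocal v)) :
    (PAdicHodge.fontainePstAdicCompletion v 3 hv).IsDeRhamFramed
      (FramedGaloisRep.toLocal v (FramedRep.dual (picardRho1 hcard b u hu))) :=
  fontainePstAdicCompletion_isDeRhamFramed_dual_toLocal v 3 hv
    (isDeRhamFramed_toLocal_picardRho1_of_isAdmissible hcard b u hu v hv hc h)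

end PicardLocal

/-! ### The witness of Upton's theorem with its de Rham clause, given the comparison theorem -/

section Witness

open Literature.NumberTheory.DiophantineGeometry Literature.NumberTheory.DiophantineGeometry.AlgFunctionField
  SuperellipticFunctionField

attribute [local instance] Ideal.Quotient.field

variable (K : Type) [Field K] [NumberField K] [IsCyclotomicExtension {3} ℚ K]
variable (f : ℤ[X]) [hf4 : Fact (f.natDegree = 4)] [hfs : Fact (f.map (Int.castRingHom ℚ)).Separable]

attribute [local instance] fact_irreducible_picard_inst picardEisensteinModule picard_isScalarTower_inst
  picard_smulCommClass_inst

variable {K f}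

set_option synthInstance.maxHeartbeats 160000 in
/-- **Upton's `ρ` with its de Rham clause, from the good-reduction datum, the twisted Lefschetz formula,
the rank and the comparison theorem.**  For a Picard quartic `f` over a number field `K ⊇ ℚ(ω)` with
`rank T₃ J(C_f) = 6`: GIVEN (`hX2`) the good-reduction datum (Serre–Tate §1 Thm. 1), (`hX3`) the twisted
Lefschetz trace formula (Milne JV Prop. 11.2) and (`hdR`) the `B_dR`-admissibility of `V₃ J(C_f)|_{Γ_{K_v}}`
for Fontaine's pinned datum at every `v ∣ 3` (Faltings 1989, `C_dR`), the framed `ρ = ρ₁^∨` of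
`picard_exists_framedGaloisRep_of_finrank_eq_six` is unramified at the good `𝔭 ∤ 3` with geometric-Frobenius
trace `j(a_𝔭(f))`, absolutely irreducible when `12 ∣ #Gal(f/ℚ)`, AND de Rham at every `v ∣ 3`
(`isDeRhamFramed_toLocal_dual_picardRho1_of_isAdmissible`).
[cite: Upton2009, Thm. 2.1 and §4] [cite: Faltings1989Crystalline, §5]
[cite: FontaineAsterisque223III, Exp. III Prop. 1.5.2] [cite: SerreTate1968GoodReduction, §1, Thm. 1]
[cite: Milne1986JacobianVarieties, §11 Prop. 11.2] -/
theorem picard_exists_framedGaloisRep_isDeRhamFramed_of_finrank_eq_six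
    (hX2 : ∀ (K : Type) [Field K] [NumberField K] (p : ℕ) [Fact p.Prime] (f : K[X]) (f₀ : (𝓞 K)[X]),
      f₀.map (algebraMap (𝓞 K) K) = f →
      ∀ (𝔭 : HeightOneSpectrum (𝓞 K)) (𝔓 : Ideal (absIntegers (𝓞 K) K)) [𝔓.IsMaximal] [𝔓.LiesOver 𝔭.asIdeal],
      (p : 𝓞 K) ∉ 𝔭.asIdeal → ¬ p ∣ f.natDegree →
      (f₀.map (Ideal.Quotient.mk 𝔭.asIdeal)).natDegree = f.natDegree →
      (f₀.map (Ideal.Quotient.mk 𝔭.asIdeal)).Separable →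
      ∀ [Fact (Irreducible (superellipticPoly K (AlgebraicClosure K) p f))]
        [Fact (Irreducible (superellipticPoly (𝓞 K ⧸ 𝔭.asIdeal) (absIntegers (𝓞 K) K ⧸ 𝔓) p
          (f₀.map (Ideal.Quotient.mk 𝔭.asIdeal))))],
      ∃ red : GeomPic K p f →+
          SuperellipticPic (𝓞 K ⧸ 𝔭.asIdeal) (absIntegers (𝓞 K) K ⧸ 𝔓) p (f₀.map (Ideal.Quotient.mk 𝔭.asIdeal)),
        (∀ (τ : MulAction.stabilizer (absoluteGaloisGroup K) 𝔓) (c : GeomPic K p f),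
            red ((τ : absoluteGaloisGroup K) • c) =
              (Ideal.Quotient.stabilizerHom 𝔓 𝔭.asIdeal (absoluteGaloisGroup K) τ) • red c) ∧
        (∀ (ζ : CyclicCoverDeck (AlgebraicClosure K) p) (c : GeomPic K p f),
            red (ζ • c) = CyclicCoverDeck.reduceMod K p 𝔓 ζ • red c) ∧
        (∀ N : ℕ, (N : 𝓞 K ⧸ 𝔭.asIdeal) ≠ 0 →
          (∀ c : GeomPic K p f, N • c = 0 → red c = 0 → c = 0) ∧
          (∀ c', N • c' = 0 → ∃ c : GeomPic K p f, N • c = 0 ∧ red c = c')))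
    (hX3 : ∀ (k : Type) [Field k] [Fintype k] (Ω : Type) [Field Ω] [Algebra k Ω] [IsAlgClosed Ω]
      [Algebra.IsAlgebraic k Ω] (p : ℕ) [Fact p.Prime] (ℓ : ℕ) [Fact ℓ.Prime] (f : k[X]),
      (p : k) ≠ 0 → (ℓ : k) ≠ 0 → f.Separable → ¬ p ∣ f.natDegree →
      ∀ [Fact (Irreducible (superellipticPoly k Ω p f))] (φ : Ω ≃ₐ[k] Ω), (∀ x : Ω, φ x = x ^ Fintype.card k) →
      ∀ (ξ : CyclicCoverDeck Ω p),
        LinearMap.trace ℚ_[ℓ] (RationalTateModule (SuperellipticPic k Ω p f) ℓ)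
          (rationalTateRepresentation (Ω ≃ₐ[k] Ω) (SuperellipticPic k Ω p f) ℓ φ ∘ₗ
            rationalTateRepresentation (CyclicCoverDeck Ω p) (SuperellipticPic k Ω p f) ℓ ξ) =
          (Fintype.card k : ℚ_[ℓ]) + 1 -
            Nat.card {P : PlaceOver Ω (SuperellipticFunctionField k Ω p f) // φ • (ξ • P) = P})
    (h6 : Module.finrank ℤ_[3] (TateModule (GeomPic K 3 (f.map (algebraMap ℤ K))) 3) = 6)
    (hdR : ∀ (v : HeightOneSpectrum (𝓞 K)) (hv : ((3 : ℕ) : 𝓞 K) ∈ v.asIdeal),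
      letI := (PAdicHodge.fontainePstAdicCompletion v 3 hv).algebra
      (PAdicHodge.fontainePstAdicCompletion v 3 hv).𝔅.IsAdmissible
        ((rationalTateGaloisRepOf (GeomPic K 3 (f.map (algebraMap ℤ K))) 3
          (picard_continuous_rationalTateRepresentation K f hf4.out hfs.out)).toLocal v))
    (j : K →+* PadicAlgCl 3) :
    ∃ ρ : FramedGaloisRep K (PadicAlgCl 3) 3,
      (∀ 𝔭 : HeightOneSpectrum (𝓞 K), (3 : 𝓞 K) ∉ 𝔭.asIdeal →
        (f.map ((Ideal.Quotient.mk 𝔭.asIdeal).comp (algebraMap ℤ (𝓞 K)))).natDegree = 4 →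
        (f.map ((Ideal.Quotient.mk 𝔭.asIdeal).comp (algebraMap ℤ (𝓞 K)))).Separable →
          ρ.IsUnramifiedAt 𝔭 ∧
          ∀ 𝔓 ∈ 𝔭.primesAbove, ∀ τ : absoluteGaloisGroup K, IsArithFrobAt (𝓞 K) τ 𝔓 →
            FramedRep.trace ρ τ⁻¹ = j (picardTrace f 𝔭 : K)) ∧
      (12 ∣ Nat.card (f.map (Int.castRingHom ℚ)).Gal → FramedRep.IsAbsolutelyIrreducible ρ) ∧
      ∀ (v : HeightOneSpectrum (𝓞 K)) (hv : ((3 : ℕ) : 𝓞 K) ∈ v.asIdeal),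
        (PAdicHodge.fontainePstAdicCompletion v 3 hv).IsDeRhamFramed (ρ.toLocal v) := by
  classical
  have hcard := picard_hcard_of_finrank_eq_six (K := K) (f := f) h6
  obtain ⟨r₀, b, hb⟩ := picard_exists_basis_repr_smul_congr K f hf4.out hfs.out (isPrimitiveRoot_zeta3 K) hcard
  have hR4 : Fintype.card ((f.map (algebraMap ℤ K)).rootSet (AlgebraicClosure K)) = 4 :=
    card_rootSet_map_algebraMap_int K hf4.out hfs.out
  have hι : Fintype.card {y : (f.map (algebraMap ℤ K)).rootSet (AlgebraicClosure K) // y ≠ r₀} = 3 := by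
    rw [Fintype.card_subtype_compl, hR4, Fintype.card_subtype_eq]
  set e := Fintype.equivFinOfCardEq hι with he
  -- `u = j(ω)²`, the other primitive cube root of unity of `ℚ̄₃`
  have hv : j (zeta3 K) ^ 2 + j (zeta3 K) + 1 = 0 := by
    set v := j (zeta3 K) with hvdef
    have hv3 : v ^ 3 = 1 := by
      rw [hvdef, ← map_pow, (isPrimitiveRoot_zeta3 K).pow_eq_one, map_one]
    have hv1 : v ≠ 1 := by
      rw [hvdef, Ne, ← map_one j, j.injective.eq_iff]
      exact (isPrimitiveRoot_zeta3 K).ne_one (by norm_num)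
    have h : (v - 1) * (v ^ 2 + v + 1) = 0 := by linear_combination hv3
    rcases mul_eq_zero.1 h with h | h
    · exact absurd (sub_eq_zero.1 h) hv1
    · exact h
  have hu : (j (zeta3 K) ^ 2) ^ 2 + j (zeta3 K) ^ 2 + 1 = 0 := sq_sq_add_sq_add_one hv
  refine ⟨FramedRep.dual (picardRho1 hcard (b.reindex e) (j (zeta3 K) ^ 2) hu), ?_, ?_, ?_⟩
  · intro 𝔭 h3 hdeg𝔭 hsep𝔭
    refine ⟨(FramedGaloisRep.isUnramifiedAt_dual_iff 𝔭 _).2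
      (picardRho1_isUnramifiedAt (K := K) (f := f) hX2 h3 hdeg𝔭 hsep𝔭 hcard _ _ hu), ?_⟩
    intro 𝔓 h𝔓 τ hτ
    exact trace_dual_picardRho1_frob_inv_of_card (K := K) (f := f) hX2 hX3 hcard _ j hu h3 hdeg𝔭 hsep𝔭 h𝔓 τ hτ
  · intro h12
    exact (picardRho1_isAbsolutelyIrreducible (K := K) (f := f) hcard h12 e b hb _ hu).dual
  · intro v hv3
    exact isDeRhamFramed_toLocal_dual_picardRho1_of_isAdmissible hcard (b.reindex e) _ hu v hv3 _ (hdR v hv3)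

/-! ### The strengthened fact over `ℚ(ω)`, modulo the named inputs -/

/-- **`picardCurve_exists_lambdaAdicRep_isDeRhamFramed` from good reduction, the twisted Lefschetz formula
and the de Rham comparison theorem for the Tate module.**  GIVEN (`hX2`) the good-reduction datum for
`y^p = f(x)` at the primes `𝔭 ∤ p` where `f mod 𝔭` stays separable of the same degree (Serre–Tate §1
Lemma 2 / Thm. 1; Deuring — proved for `p = 3` in `PicardGoodReductionDeuring`, privately), (`hX3`) the
twisted Lefschetz trace formula on `V_ℓ Pic` of `y^p = f(x)` over finite fields (Milne JV §11 Prop. 11.2;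
reduced in the tree to Weil's theorem, `picardCurve_exists_lambdaAdicRep_of_degreeFunction_etale`), and
(`hdR`) **the de Rham comparison theorem for the Picard curves at `λ`**: for every Picard quartic `f` and
every place `v ∣ 3` of `ℚ(ω)`, the rational Tate module `V₃ J(C_f) = ℚ₃ ⊗ T₃ Pic(C_{f, \overline{ℚ(ω)}})`
restricted to `Γ_{ℚ(ω)_v}` is `B_dR`-admissible for Fontaine's pinned datum
`PAdicHodge.fontainePstAdicCompletion v 3 hv` (Faltings 1989, `C_dR` for `H¹` of the smooth proper curve
`C_f` over the `3`-adic field `ℚ(ω)_v`; for abelian varieties Fontaine–Messing 1987; Tsuji 1999 +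
de Jong 1996), the strengthened fact holds — with `ρ = ρ₁^∨`, the rank `6` coming from Chebotarev and
Hasse–Weil (`picard_nontrivial_tateModule`, `picard_finrank_tateModule_eq_six_of_nontrivial`) and the de
Rham clause from `isDeRhamWith_toLocal_picardRho1_of_isAdmissible` (this file) and the dual case of
Fontaine's Prop. 1.5.2 (`PstWeilDeligneDualDeRham`).  The three inputs stay explicit hypotheses, not
named facts.
[cite: Upton2009, Thm. 2.1 and §4] [cite: Faltings1989Crystalline, §5] [cite: Tsuji1999Cst, Thm. 0.2]
[cite: FontaineAsterisque223III, Exp. III §1.5 and Prop. 1.5.2] [cite: SerreTate1968GoodReduction, §1, Thm. 1]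
[cite: Milne1986JacobianVarieties, §11 Prop. 11.2] -/
theorem picardCurve_exists_lambdaAdicRep_isDeRhamFramed_of_goodReduction_lefschetz_of_isDeRham
    (hX2 : ∀ (K : Type) [Field K] [NumberField K] (p : ℕ) [Fact p.Prime] (f : K[X]) (f₀ : (𝓞 K)[X]),
      f₀.map (algebraMap (𝓞 K) K) = f →
      ∀ (𝔭 : HeightOneSpectrum (𝓞 K)) (𝔓 : Ideal (absIntegers (𝓞 K) K)) [𝔓.IsMaximal] [𝔓.LiesOver 𝔭.asIdeal],
      (p : 𝓞 K) ∉ 𝔭.asIdeal → ¬ p ∣ f.natDegree →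
      (f₀.map (Ideal.Quotient.mk 𝔭.asIdeal)).natDegree = f.natDegree →
      (f₀.map (Ideal.Quotient.mk 𝔭.asIdeal)).Separable →
      ∀ [Fact (Irreducible (superellipticPoly K (AlgebraicClosure K) p f))]
        [Fact (Irreducible (superellipticPoly (𝓞 K ⧸ 𝔭.asIdeal) (absIntegers (𝓞 K) K ⧸ 𝔓) p
          (f₀.map (Ideal.Quotient.mk 𝔭.asIdeal))))],
      ∃ red : GeomPic K p f →+
          SuperellipticPic (𝓞 K ⧸ 𝔭.asIdeal) (absIntegers (𝓞 K) K ⧸ 𝔓) p (f₀.map (Ideal.Quotient.mk 𝔭.asIdeal)),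
        (∀ (τ : MulAction.stabilizer (absoluteGaloisGroup K) 𝔓) (c : GeomPic K p f),
            red ((τ : absoluteGaloisGroup K) • c) =
              (Ideal.Quotient.stabilizerHom 𝔓 𝔭.asIdeal (absoluteGaloisGroup K) τ) • red c) ∧
        (∀ (ζ : CyclicCoverDeck (AlgebraicClosure K) p) (c : GeomPic K p f),
            red (ζ • c) = CyclicCoverDeck.reduceMod K p 𝔓 ζ • red c) ∧
        (∀ N : ℕ, (N : 𝓞 K ⧸ 𝔭.asIdeal) ≠ 0 →
          (∀ c : GeomPic K p f, N • c = 0 → red c = 0 → c = 0) ∧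
          (∀ c', N • c' = 0 → ∃ c : GeomPic K p f, N • c = 0 ∧ red c = c')))
    (hX3 : ∀ (k : Type) [Field k] [Fintype k] (Ω : Type) [Field Ω] [Algebra k Ω] [IsAlgClosed Ω]
      [Algebra.IsAlgebraic k Ω] (p : ℕ) [Fact p.Prime] (ℓ : ℕ) [Fact ℓ.Prime] (f : k[X]),
      (p : k) ≠ 0 → (ℓ : k) ≠ 0 → f.Separable → ¬ p ∣ f.natDegree →
      ∀ [Fact (Irreducible (superellipticPoly k Ω p f))] (φ : Ω ≃ₐ[k] Ω), (∀ x : Ω, φ x = x ^ Fintype.card k) →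
      ∀ (ξ : CyclicCoverDeck Ω p),
        LinearMap.trace ℚ_[ℓ] (RationalTateModule (SuperellipticPic k Ω p f) ℓ)
          (rationalTateRepresentation (Ω ≃ₐ[k] Ω) (SuperellipticPic k Ω p f) ℓ φ ∘ₗ
            rationalTateRepresentation (CyclicCoverDeck Ω p) (SuperellipticPic k Ω p f) ℓ ξ) =
          (Fintype.card k : ℚ_[ℓ]) + 1 -
            Nat.card {P : PlaceOver Ω (SuperellipticFunctionField k Ω p f) // φ • (ξ • P) = P})
    (hdR : ∀ (K : Type) [Field K] [NumberField K] [IsCyclotomicExtension {3} ℚ K]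
      (f : ℤ[X]) (h4 : f.natDegree = 4) (hsep : (f.map (Int.castRingHom ℚ)).Separable)
      (v : HeightOneSpectrum (𝓞 K)) (hv : ((3 : ℕ) : 𝓞 K) ∈ v.asIdeal),
      haveI := fact_irreducible_superellipticPoly_picard K h4 hsep
      letI := (PAdicHodge.fontainePstAdicCompletion v 3 hv).algebra
      (PAdicHodge.fontainePstAdicCompletion v 3 hv).𝔅.IsAdmissible
        ((rationalTateGaloisRepOf (GeomPic K 3 (f.map (algebraMap ℤ K))) 3
          (picard_continuous_rationalTateRepresentation K f h4 hsep)).toLocal v)) :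
    picardCurve_exists_lambdaAdicRep_isDeRhamFramed := by
  intro f h4 hsep j
  classical
  haveI : IsCyclotomicExtension {3} ℚ (CyclotomicField 3 ℚ) := CyclotomicField.isCyclotomicExtension 3 ℚ
  haveI hf4 : Fact (f.natDegree = 4) := ⟨h4⟩
  haveI hfs : Fact (f.map (Int.castRingHom ℚ)).Separable := ⟨hsep⟩
  haveI := picard_nontrivial_tateModule (K := CyclotomicField 3 ℚ) (f := f) hX2 hX3
  exact picard_exists_framedGaloisRep_isDeRhamFramed_of_finrank_eq_six (K := CyclotomicField 3 ℚ) (f := f)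
    hX2 hX3 (picard_finrank_tateModule_eq_six_of_nontrivial (K := CyclotomicField 3 ℚ) (f := f) hX2 hX3)
    (hdR (CyclotomicField 3 ℚ) f h4 hsep) j

/-- **The same from good reduction, Weil's UNTWISTED trace formula and the comparison theorem**: the
twisted formula `hX3` is `superelliptic_lefschetz_twisted_of_weil hW` (Milne, *Jacobian varieties*,
Thm. 11.1 verbatim for the curves `y^p = f(x)` over finite fields).
[cite: Upton2009, Thm. 2.1 and §4] [cite: Faltings1989Crystalline, §5]
[cite: Milne1986JacobianVarieties, Thm. 11.1] [cite: SerreTate1968GoodReduction, §1, Thm. 1] -/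
theorem picardCurve_exists_lambdaAdicRep_isDeRhamFramed_of_goodReduction_weil_of_isDeRham
    (hX2 : ∀ (K : Type) [Field K] [NumberField K] (p : ℕ) [Fact p.Prime] (f : K[X]) (f₀ : (𝓞 K)[X]),
      f₀.map (algebraMap (𝓞 K) K) = f →
      ∀ (𝔭 : HeightOneSpectrum (𝓞 K)) (𝔓 : Ideal (absIntegers (𝓞 K) K)) [𝔓.IsMaximal] [𝔓.LiesOver 𝔭.asIdeal],
      (p : 𝓞 K) ∉ 𝔭.asIdeal → ¬ p ∣ f.natDegree →
      (f₀.map (Ideal.Quotient.mk 𝔭.asIdeal)).natDegree = f.natDegree →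
      (f₀.map (Ideal.Quotient.mk 𝔭.asIdeal)).Separable →
      ∀ [Fact (Irreducible (superellipticPoly K (AlgebraicClosure K) p f))]
        [Fact (Irreducible (superellipticPoly (𝓞 K ⧸ 𝔭.asIdeal) (absIntegers (𝓞 K) K ⧸ 𝔓) p
          (f₀.map (Ideal.Quotient.mk 𝔭.asIdeal))))],
      ∃ red : GeomPic K p f →+
          SuperellipticPic (𝓞 K ⧸ 𝔭.asIdeal) (absIntegers (𝓞 K) K ⧸ 𝔓) p (f₀.map (Ideal.Quotient.mk 𝔭.asIdeal)),
        (∀ (τ : MulAction.stabilizer (absoluteGaloisGroup K) 𝔓) (c : GeomPic K p f),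
            red ((τ : absoluteGaloisGroup K) • c) =
              (Ideal.Quotient.stabilizerHom 𝔓 𝔭.asIdeal (absoluteGaloisGroup K) τ) • red c) ∧
        (∀ (ζ : CyclicCoverDeck (AlgebraicClosure K) p) (c : GeomPic K p f),
            red (ζ • c) = CyclicCoverDeck.reduceMod K p 𝔓 ζ • red c) ∧
        (∀ N : ℕ, (N : 𝓞 K ⧸ 𝔭.asIdeal) ≠ 0 →
          (∀ c : GeomPic K p f, N • c = 0 → red c = 0 → c = 0) ∧
          (∀ c', N • c' = 0 → ∃ c : GeomPic K p f, N • c = 0 ∧ red c = c')))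
    (hW : ∀ (k : Type) [Field k] [Fintype k] (Ω : Type) [Field Ω] [Algebra k Ω] [IsAlgClosed Ω]
      [Algebra.IsAlgebraic k Ω] (p : ℕ) [Fact p.Prime] (ℓ : ℕ) [Fact ℓ.Prime] (f : k[X]),
      (p : k) ≠ 0 → (ℓ : k) ≠ 0 → f.Separable → ¬ p ∣ f.natDegree →
      ∀ [Fact (Irreducible (superellipticPoly k Ω p f))] (φ : Ω ≃ₐ[k] Ω), (∀ x : Ω, φ x = x ^ Fintype.card k) →
        LinearMap.trace ℚ_[ℓ] (RationalTateModule (SuperellipticPic k Ω p f) ℓ)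
          (rationalTateRepresentation (Ω ≃ₐ[k] Ω) (SuperellipticPic k Ω p f) ℓ φ) =
          (Fintype.card k : ℚ_[ℓ]) + 1 -
            Nat.card {P : PlaceOver Ω (SuperellipticFunctionField k Ω p f) // φ • P = P})
    (hdR : ∀ (K : Type) [Field K] [NumberField K] [IsCyclotomicExtension {3} ℚ K]
      (f : ℤ[X]) (h4 : f.natDegree = 4) (hsep : (f.map (Int.castRingHom ℚ)).Separable)
      (v : HeightOneSpectrum (𝓞 K)) (hv : ((3 : ℕ) : 𝓞 K) ∈ v.asIdeal),
      haveI := fact_irreducible_superellipticPoly_picard K h4 hsep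
      letI := (PAdicHodge.fontainePstAdicCompletion v 3 hv).algebra
      (PAdicHodge.fontainePstAdicCompletion v 3 hv).𝔅.IsAdmissible
        ((rationalTateGaloisRepOf (GeomPic K 3 (f.map (algebraMap ℤ K))) 3
          (picard_continuous_rationalTateRepresentation K f h4 hsep)).toLocal v)) :
    picardCurve_exists_lambdaAdicRep_isDeRhamFramed :=
  picardCurve_exists_lambdaAdicRep_isDeRhamFramed_of_goodReduction_lefschetz_of_isDeRham hX2
    (superelliptic_lefschetz_twisted_of_weil hW) hdR

end Witness

/-! ### The geometric inputs over finite fields: degree function ⟹ `deg = det` ⟹ Weil's trace formula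

Standalone forms of the transformations carried out INLINE in `PicardFrobeniusDegDet` and
`PicardFrobeniusDegreeFunctionEtale` (same statements, same proofs), so that the de Rham doors below descend
to the same deepest input `hδ` as `picardCurve_exists_lambdaAdicRep_of_degreeFunction_etale`. -/

section FiniteFieldInputs

open scoped Classical AddSubgroup
open Literature.NumberTheory.DiophantineGeometry Literature.NumberTheory.DiophantineGeometry.AlgFunctionField
  Literature.NumberTheory.LFunctions SuperellipticFunctionField

/-- **Weil's trace formula from `deg = det`** (the inline argument of `picardCurve_exists_lambdaAdicRep_of_degdet`,
stated on its own): `Tr V_ℓ(φ) = Σ αᵢ = q + 1 - N₁` from `det(1 - V_ℓ(φ)^r) = #Pic⁰(C_Ω)^{φ^r} = ∏ᵢ (1 - αᵢ^r)`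
(`exists_natCard_fixed_degreeZero_eq_prod`, `FrobeniusCharpoly.trace_eq_intCast`) and `N₁ = #{Q : φ Q = Q}`
(`natCard_fixedPlaces_frobenius_eq_pointCount_one`).
[cite: MumfordAV1970, §19 Thm. 4, §21] [cite: Milne1986AbelianVarieties, Thm. 19.1] [cite: Milne1986JacobianVarieties, §11 Thm. 11.1] -/
theorem superelliptic_weil_of_degdet
    (hD : ∀ (k : Type) [Field k] [Fintype k] (Ω : Type) [Field Ω] [Algebra k Ω] [IsAlgClosed Ω]
      [Algebra.IsAlgebraic k Ω] (p : ℕ) [Fact p.Prime] (ℓ : ℕ) [Fact ℓ.Prime] (f : k[X]),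
      (p : k) ≠ 0 → (ℓ : k) ≠ 0 → f.Separable → ¬ p ∣ f.natDegree →
      ∀ [Fact (Irreducible (superellipticPoly k Ω p f))] (φ : Ω ≃ₐ[k] Ω), (∀ x : Ω, φ x = x ^ Fintype.card k) →
        ∃ _ : Module.Finite ℚ_[ℓ] (RationalTateModule (SuperellipticPic k Ω p f) ℓ),
          ∀ r : ℕ, 0 < r →
            LinearMap.det (1 - rationalTateRepresentation (Ω ≃ₐ[k] Ω) (SuperellipticPic k Ω p f) ℓ φ ^ r) =
              (Nat.card {c : SuperellipticPic k Ω p f //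
                SuperellipticPic.degree k Ω p f c = 0 ∧ (φ ^ r) • c = c} : ℚ_[ℓ])) :
    ∀ (k : Type) [Field k] [Fintype k] (Ω : Type) [Field Ω] [Algebra k Ω] [IsAlgClosed Ω]
      [Algebra.IsAlgebraic k Ω] (p : ℕ) [Fact p.Prime] (ℓ : ℕ) [Fact ℓ.Prime] (f : k[X]),
      (p : k) ≠ 0 → (ℓ : k) ≠ 0 → f.Separable → ¬ p ∣ f.natDegree →
      ∀ [Fact (Irreducible (superellipticPoly k Ω p f))] (φ : Ω ≃ₐ[k] Ω), (∀ x : Ω, φ x = x ^ Fintype.card k) →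
        LinearMap.trace ℚ_[ℓ] (RationalTateModule (SuperellipticPic k Ω p f) ℓ)
          (rationalTateRepresentation (Ω ≃ₐ[k] Ω) (SuperellipticPic k Ω p f) ℓ φ) =
          (Fintype.card k : ℚ_[ℓ]) + 1 -
            Nat.card {P : PlaceOver Ω (SuperellipticFunctionField k Ω p f) // φ • P = P} := by
  intro k _ _ Ω _ _ _ _ p _ ℓ _ f hpk hℓk hsep hndvd _ φ hφ
  have hdeg : 0 < f.natDegree := Nat.pos_of_ne_zero fun h => hndvd (by rw [h]; exact dvd_zero p)
  haveI : Fact (Irreducible (superellipticPoly k k p f)) := fact_irreducible_superellipticPoly k k f hsep hdeg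
  obtain ⟨hfin, hdet⟩ := hD k Ω p ℓ f hpk hℓk hsep hndvd φ hφ
  obtain ⟨α, hαn, hαN, hh⟩ := exists_natCard_fixed_degreeZero_eq_prod (Ω := Ω) φ hφ hpk hsep hndvd
  obtain ⟨e⟩ := PadicAlgCl.nonempty_ringEquiv_complex ℓ
  set ρ := rationalTateRepresentation (Ω ≃ₐ[k] Ω) (SuperellipticPic k Ω p f) ℓ with hρ
  -- `V_ℓ(φ)` is invertible
  have hf : LinearMap.det (ρ φ) ≠ 0 := by
    have h : LinearMap.det (ρ φ) * LinearMap.det (ρ φ⁻¹) = 1 := by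
      rw [← map_mul, ← map_mul, mul_inv_cancel, map_one, map_one]
    exact left_ne_zero_of_mul_eq_one h
  have hc : (1 : ℝ) < √(Fintype.card k : ℝ) := by
    rw [show (1 : ℝ) = √1 from Real.sqrt_one.symm]
    exact Real.sqrt_lt_sqrt zero_le_one (by exact_mod_cast Fintype.one_lt_card)
  have ht : (((Fintype.card k : ℤ) + 1 - (pointCount k (SuperellipticFunctionField k k p f) 1 : ℤ) : ℤ) : ℂ) =
      ∑ i, α i := by
    have h1 := hαN 1 Nat.one_pos
    simp only [pow_one] at h1
    push_cast
    linear_combination -h1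
  have key := FrobeniusCharpoly.trace_eq_intCast (K := PadicAlgCl ℓ) (e : PadicAlgCl ℓ →+* ℂ) (f := ρ φ)
    (N := fun r => (Nat.card {c : SuperellipticPic k Ω p f //
      SuperellipticPic.degree k Ω p f c = 0 ∧ (φ ^ r) • c = c} : ℤ))
    hf hc hαn (fun r hr => by rw [hdet r hr]; simp) (fun r hr => by rw [← hh r hr]; simp) ht
  rw [key, ← natCard_fixedPlaces_frobenius_eq_pointCount_one φ hφ hpk hsep hndvd]
  push_cast
  ring

/-- **`deg = det` from a degree function with étale kernel counts** (the inline argument of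
`picardCurve_exists_lambdaAdicRep_of_degreeFunction_etale`, stated on its own): Milne AV Prop. 12.9 in the tree's
form `RationalTateModule.det_one_sub_pow_eq_of_degreeFunction_of_shift`, the shifts `F + c ℓ^M` making `F(φ)` étale
(`exists_shift_coeff_zero_cast_ne_zero`).
[cite: MumfordAV1970, §19 Thm. 2, Thm. 4, §21] [cite: Milne1986AbelianVarieties, §12 Prop. 12.9, §19 Thm. 19.1 (proof)] -/
theorem superelliptic_degdet_of_degreeFunction_etale
    (hδ : ∀ (k : Type) [Field k] [Fintype k] (Ω : Type) [Field Ω] [Algebra k Ω] [IsAlgClosed Ω]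
      [Algebra.IsAlgebraic k Ω] (p : ℕ) [Fact p.Prime] (ℓ : ℕ) [Fact ℓ.Prime] (f : k[X]),
      (p : k) ≠ 0 → (ℓ : k) ≠ 0 → f.Separable → ¬ p ∣ f.natDegree →
      ∀ [Fact (Irreducible (superellipticPoly k Ω p f))] (φ : Ω ≃ₐ[k] Ω), (∀ x : Ω, φ x = x ^ Fintype.card k) →
        ∃ g : ℕ, (∀ n, Nat.card ((SuperellipticPic k Ω p f)[(ℓ ^ n : ℕ)]) = ℓ ^ (2 * g * n)) ∧
        ∃ (δ : ℤ[X] → ℤ) (P : ℤ[X]), (∀ F G : ℤ[X], δ (F * G) = δ F * δ G) ∧ P.Monic ∧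
          (∀ m : ℤ, P.eval m = δ (X - C m)) ∧
          (∀ e : ℕ, ∃ H : MvPolynomial (Fin e) ℚ, ∀ c : Fin e → ℤ,
            (δ (X ^ e + ∑ i : Fin e, C (c i) * X ^ (i : ℕ)) : ℚ) = MvPolynomial.eval (fun i => (c i : ℚ)) H) ∧
          (∀ F : ℤ[X], F.Monic → ((F.coeff 0 : ℤ) : k) ≠ 0 → δ F ≠ 0 →
            {a : SuperellipticPic k Ω p f | (∃ n : ℕ, ℓ ^ n • a = 0) ∧
                (aeval (DistribMulAction.toAddMonoidEnd (Ω ≃ₐ[k] Ω) (SuperellipticPic k Ω p f) φ) F :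
                  AddMonoid.End (SuperellipticPic k Ω p f)) a = 0}.Finite ∧
              Nat.card {a : SuperellipticPic k Ω p f | (∃ n : ℕ, ℓ ^ n • a = 0) ∧
                (aeval (DistribMulAction.toAddMonoidEnd (Ω ≃ₐ[k] Ω) (SuperellipticPic k Ω p f) φ) F :
                  AddMonoid.End (SuperellipticPic k Ω p f)) a = 0} = ℓ ^ padicValInt ℓ (δ F)) ∧
          (∀ r : ℕ, 0 < r → δ (X ^ r - 1) =
            Nat.card {c : SuperellipticPic k Ω p f //
              SuperellipticPic.degree k Ω p f c = 0 ∧ (φ ^ r) • c = c})) :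
    ∀ (k : Type) [Field k] [Fintype k] (Ω : Type) [Field Ω] [Algebra k Ω] [IsAlgClosed Ω]
      [Algebra.IsAlgebraic k Ω] (p : ℕ) [Fact p.Prime] (ℓ : ℕ) [Fact ℓ.Prime] (f : k[X]),
      (p : k) ≠ 0 → (ℓ : k) ≠ 0 → f.Separable → ¬ p ∣ f.natDegree →
      ∀ [Fact (Irreducible (superellipticPoly k Ω p f))] (φ : Ω ≃ₐ[k] Ω), (∀ x : Ω, φ x = x ^ Fintype.card k) →
        ∃ _ : Module.Finite ℚ_[ℓ] (RationalTateModule (SuperellipticPic k Ω p f) ℓ),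
          ∀ r : ℕ, 0 < r →
            LinearMap.det (1 - rationalTateRepresentation (Ω ≃ₐ[k] Ω) (SuperellipticPic k Ω p f) ℓ φ ^ r) =
              (Nat.card {c : SuperellipticPic k Ω p f //
                SuperellipticPic.degree k Ω p f c = 0 ∧ (φ ^ r) • c = c} : ℚ_[ℓ]) := by
  intro k _ _ Ω _ _ _ _ p _ ℓ _ f hpk hℓk hsep hndvd _ φ hφ
  obtain ⟨g, hcard, δ, P, hmul, hP, hPδ, hpoly, hker, hfix⟩ := hδ k Ω p ℓ f hpk hℓk hsep hndvd φ hφ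
  have hcard' : ∀ n, Nat.card ((SuperellipticPic k Ω p f)[(ℓ ^ n : ℕ)]) = ℓ ^ ((2 * g) * n) := hcard
  haveI := TateModule.free_of_card_torsionBy_rank hcard'
  haveI := TateModule.finite_of_card_torsionBy_rank hcard'
  refine ⟨RationalTateModule.finite_of_card_torsionBy_rank hcard', fun r hr => ?_⟩
  rw [RationalTateModule.det_one_sub_pow_eq_of_degreeFunction_of_shift hcard' φ hmul hP hPδ hpoly
    (S := fun F : ℤ[X] => ((F.coeff 0 : ℤ) : k) ≠ 0)
    (fun F _ M => exists_shift_coeff_zero_cast_ne_zero k hℓk F M) hker hr, hfix r hr]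
  push_cast
  rw [show 2 * g * (r + 1) = 2 * (g * (r + 1)) by ring, pow_mul, neg_one_sq, one_pow, one_mul]

end FiniteFieldInputs

/-! ### The doors without the good-reduction hypothesis (Deuring's datum is a theorem), down to `hδ` -/

section DeuringWitness

open scoped AddSubgroup
open Literature.NumberTheory.DiophantineGeometry Literature.NumberTheory.DiophantineGeometry.AlgFunctionField
  SuperellipticFunctionField

attribute [local instance] Ideal.Quotient.field

variable (K : Type) [Field K] [NumberField K] [IsCyclotomicExtension {3} ℚ K]
variable (f : ℤ[X]) [hf4 : Fact (f.natDegree = 4)] [hfs : Fact (f.map (Int.castRingHom ℚ)).Separable]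

attribute [local instance] fact_irreducible_picard_inst picardEisensteinModule picard_isScalarTower_inst
  picard_smulCommClass_inst

variable {K f}

set_option synthInstance.maxHeartbeats 160000 in
/-- **Upton's `ρ` with its de Rham clause, from the twisted Lefschetz formula, the rank and the comparison
theorem** — `picard_exists_framedGaloisRep_isDeRhamFramed_of_finrank_eq_six` with the good-reduction datum `hX2`
SUPPLIED by Deuring's theorem (`picardRho1_isUnramifiedAt_deuringDatum`,
`trace_dual_picardRho1_frob_inv_of_card_deuringDatum` of `PicardGoodReductionDeuring`).
[cite: Upton2009, Thm. 2.1 and §4] [cite: Faltings1989Crystalline, Ch. VIII Thm. 8.1]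
[cite: Deuring1942Reduktion, §4] [cite: Milne1986JacobianVarieties, §11 Prop. 11.2] -/
theorem picard_exists_framedGaloisRep_isDeRhamFramed_of_finrank_eq_six_deuring
    (hX3 : ∀ (k : Type) [Field k] [Fintype k] (Ω : Type) [Field Ω] [Algebra k Ω] [IsAlgClosed Ω]
      [Algebra.IsAlgebraic k Ω] (p : ℕ) [Fact p.Prime] (ℓ : ℕ) [Fact ℓ.Prime] (f : k[X]),
      (p : k) ≠ 0 → (ℓ : k) ≠ 0 → f.Separable → ¬ p ∣ f.natDegree →
      ∀ [Fact (Irreducible (superellipticPoly k Ω p f))] (φ : Ω ≃ₐ[k] Ω), (∀ x : Ω, φ x = x ^ Fintype.card k) →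
      ∀ (ξ : CyclicCoverDeck Ω p),
        LinearMap.trace ℚ_[ℓ] (RationalTateModule (SuperellipticPic k Ω p f) ℓ)
          (rationalTateRepresentation (Ω ≃ₐ[k] Ω) (SuperellipticPic k Ω p f) ℓ φ ∘ₗ
            rationalTateRepresentation (CyclicCoverDeck Ω p) (SuperellipticPic k Ω p f) ℓ ξ) =
          (Fintype.card k : ℚ_[ℓ]) + 1 -
            Nat.card {P : PlaceOver Ω (SuperellipticFunctionField k Ω p f) // φ • (ξ • P) = P})
    (h6 : Module.finrank ℤ_[3] (TateModule (GeomPic K 3 (f.map (algebraMap ℤ K))) 3) = 6)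
    (hdR : ∀ (v : HeightOneSpectrum (𝓞 K)) (hv : ((3 : ℕ) : 𝓞 K) ∈ v.asIdeal),
      letI := (PAdicHodge.fontainePstAdicCompletion v 3 hv).algebra
      (PAdicHodge.fontainePstAdicCompletion v 3 hv).𝔅.IsAdmissible
        ((rationalTateGaloisRepOf (GeomPic K 3 (f.map (algebraMap ℤ K))) 3
          (picard_continuous_rationalTateRepresentation K f hf4.out hfs.out)).toLocal v))
    (j : K →+* PadicAlgCl 3) :
    ∃ ρ : FramedGaloisRep K (PadicAlgCl 3) 3,
      (∀ 𝔭 : HeightOneSpectrum (𝓞 K), (3 : 𝓞 K) ∉ 𝔭.asIdeal →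
        (f.map ((Ideal.Quotient.mk 𝔭.asIdeal).comp (algebraMap ℤ (𝓞 K)))).natDegree = 4 →
        (f.map ((Ideal.Quotient.mk 𝔭.asIdeal).comp (algebraMap ℤ (𝓞 K)))).Separable →
          ρ.IsUnramifiedAt 𝔭 ∧
          ∀ 𝔓 ∈ 𝔭.primesAbove, ∀ τ : absoluteGaloisGroup K, IsArithFrobAt (𝓞 K) τ 𝔓 →
            FramedRep.trace ρ τ⁻¹ = j (picardTrace f 𝔭 : K)) ∧
      (12 ∣ Nat.card (f.map (Int.castRingHom ℚ)).Gal → FramedRep.IsAbsolutelyIrreducible ρ) ∧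
      ∀ (v : HeightOneSpectrum (𝓞 K)) (hv : ((3 : ℕ) : 𝓞 K) ∈ v.asIdeal),
        (PAdicHodge.fontainePstAdicCompletion v 3 hv).IsDeRhamFramed (ρ.toLocal v) := by
  classical
  have hcard := picard_hcard_of_finrank_eq_six (K := K) (f := f) h6
  obtain ⟨r₀, b, hb⟩ := picard_exists_basis_repr_smul_congr K f hf4.out hfs.out (isPrimitiveRoot_zeta3 K) hcard
  have hR4 : Fintype.card ((f.map (algebraMap ℤ K)).rootSet (AlgebraicClosure K)) = 4 :=
    card_rootSet_map_algebraMap_int K hf4.out hfs.out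
  have hι : Fintype.card {y : (f.map (algebraMap ℤ K)).rootSet (AlgebraicClosure K) // y ≠ r₀} = 3 := by
    rw [Fintype.card_subtype_compl, hR4, Fintype.card_subtype_eq]
  set e := Fintype.equivFinOfCardEq hι with he
  -- `u = j(ω)²`, the other primitive cube root of unity of `ℚ̄₃`
  have hv : j (zeta3 K) ^ 2 + j (zeta3 K) + 1 = 0 := by
    set v := j (zeta3 K) with hvdef
    have hv3 : v ^ 3 = 1 := by
      rw [hvdef, ← map_pow, (isPrimitiveRoot_zeta3 K).pow_eq_one, map_one]
    have hv1 : v ≠ 1 := by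
      rw [hvdef, Ne, ← map_one j, j.injective.eq_iff]
      exact (isPrimitiveRoot_zeta3 K).ne_one (by norm_num)
    have h : (v - 1) * (v ^ 2 + v + 1) = 0 := by linear_combination hv3
    rcases mul_eq_zero.1 h with h | h
    · exact absurd (sub_eq_zero.1 h) hv1
    · exact h
  have hu : (j (zeta3 K) ^ 2) ^ 2 + j (zeta3 K) ^ 2 + 1 = 0 := sq_sq_add_sq_add_one hv
  refine ⟨FramedRep.dual (picardRho1 hcard (b.reindex e) (j (zeta3 K) ^ 2) hu), ?_, ?_, ?_⟩
  · intro 𝔭 h3 hdeg𝔭 hsep𝔭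
    refine ⟨(FramedGaloisRep.isUnramifiedAt_dual_iff 𝔭 _).2
      (picardRho1_isUnramifiedAt_deuringDatum (K := K) (f := f) h3 hdeg𝔭 hsep𝔭 hcard _ _ hu), ?_⟩
    intro 𝔓 h𝔓 τ hτ
    exact trace_dual_picardRho1_frob_inv_of_card_deuringDatum (K := K) (f := f) hX3 hcard _ j hu h3 hdeg𝔭 hsep𝔭
      h𝔓 τ hτ
  · intro h12
    exact (picardRho1_isAbsolutelyIrreducible (K := K) (f := f) hcard h12 e b hb _ hu).dual
  · intro v hv3
    exact isDeRhamFramed_toLocal_dual_picardRho1_of_isAdmissible hcard (b.reindex e) _ hu v hv3 _ (hdR v hv3)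

/-- **`picardCurve_exists_lambdaAdicRep_isDeRhamFramed` from the twisted Lefschetz formula and the comparison
theorem ALONE** (the good-reduction datum being Deuring's theorem; rank `6` by
`picard_finrank_tateModule_eq_six_deuringDatum`): the de Rham companion of
`picardCurve_exists_lambdaAdicRep_of_lefschetz`.
[cite: Upton2009, Thm. 2.1 and §4] [cite: Faltings1989Crystalline, Ch. VIII Thm. 8.1]
[cite: Milne1986JacobianVarieties, §11 Prop. 11.2] [cite: Deuring1942Reduktion, §4] -/
theorem picardCurve_exists_lambdaAdicRep_isDeRhamFramed_of_lefschetz_of_isDeRham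
    (hX3 : ∀ (k : Type) [Field k] [Fintype k] (Ω : Type) [Field Ω] [Algebra k Ω] [IsAlgClosed Ω]
      [Algebra.IsAlgebraic k Ω] (p : ℕ) [Fact p.Prime] (ℓ : ℕ) [Fact ℓ.Prime] (f : k[X]),
      (p : k) ≠ 0 → (ℓ : k) ≠ 0 → f.Separable → ¬ p ∣ f.natDegree →
      ∀ [Fact (Irreducible (superellipticPoly k Ω p f))] (φ : Ω ≃ₐ[k] Ω), (∀ x : Ω, φ x = x ^ Fintype.card k) →
      ∀ (ξ : CyclicCoverDeck Ω p),
        LinearMap.trace ℚ_[ℓ] (RationalTateModule (SuperellipticPic k Ω p f) ℓ)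
          (rationalTateRepresentation (Ω ≃ₐ[k] Ω) (SuperellipticPic k Ω p f) ℓ φ ∘ₗ
            rationalTateRepresentation (CyclicCoverDeck Ω p) (SuperellipticPic k Ω p f) ℓ ξ) =
          (Fintype.card k : ℚ_[ℓ]) + 1 -
            Nat.card {P : PlaceOver Ω (SuperellipticFunctionField k Ω p f) // φ • (ξ • P) = P})
    (hdR : ∀ (K : Type) [Field K] [NumberField K] [IsCyclotomicExtension {3} ℚ K]
      (f : ℤ[X]) (h4 : f.natDegree = 4) (hsep : (f.map (Int.castRingHom ℚ)).Separable)
      (v : HeightOneSpectrum (𝓞 K)) (hv : ((3 : ℕ) : 𝓞 K) ∈ v.asIdeal),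
      haveI := fact_irreducible_superellipticPoly_picard K h4 hsep
      letI := (PAdicHodge.fontainePstAdicCompletion v 3 hv).algebra
      (PAdicHodge.fontainePstAdicCompletion v 3 hv).𝔅.IsAdmissible
        ((rationalTateGaloisRepOf (GeomPic K 3 (f.map (algebraMap ℤ K))) 3
          (picard_continuous_rationalTateRepresentation K f h4 hsep)).toLocal v)) :
    picardCurve_exists_lambdaAdicRep_isDeRhamFramed := by
  intro f h4 hsep j
  classical
  haveI : IsCyclotomicExtension {3} ℚ (CyclotomicField 3 ℚ) := CyclotomicField.isCyclotomicExtension 3 ℚ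
  haveI hf4 : Fact (f.natDegree = 4) := ⟨h4⟩
  haveI hfs : Fact (f.map (Int.castRingHom ℚ)).Separable := ⟨hsep⟩
  exact picard_exists_framedGaloisRep_isDeRhamFramed_of_finrank_eq_six_deuring (K := CyclotomicField 3 ℚ) (f := f)
    hX3 (picard_finrank_tateModule_eq_six_deuringDatum (K := CyclotomicField 3 ℚ) (f := f) hX3)
    (hdR (CyclotomicField 3 ℚ) f h4 hsep) j

/-- **`picardCurve_exists_lambdaAdicRep_isDeRhamFramed` from Weil's trace formula and the comparison theorem**
(the de Rham companion of `picardCurve_exists_lambdaAdicRep_of_weil`; `hX3 := superelliptic_lefschetz_twisted_of_weil hW`).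
[cite: Upton2009, Thm. 2.1 and §4] [cite: Faltings1989Crystalline, Ch. VIII Thm. 8.1]
[cite: Milne1986JacobianVarieties, Thm. 11.1] -/
theorem picardCurve_exists_lambdaAdicRep_isDeRhamFramed_of_weil_of_isDeRham
    (hW : ∀ (k : Type) [Field k] [Fintype k] (Ω : Type) [Field Ω] [Algebra k Ω] [IsAlgClosed Ω]
      [Algebra.IsAlgebraic k Ω] (p : ℕ) [Fact p.Prime] (ℓ : ℕ) [Fact ℓ.Prime] (f : k[X]),
      (p : k) ≠ 0 → (ℓ : k) ≠ 0 → f.Separable → ¬ p ∣ f.natDegree →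
      ∀ [Fact (Irreducible (superellipticPoly k Ω p f))] (φ : Ω ≃ₐ[k] Ω), (∀ x : Ω, φ x = x ^ Fintype.card k) →
        LinearMap.trace ℚ_[ℓ] (RationalTateModule (SuperellipticPic k Ω p f) ℓ)
          (rationalTateRepresentation (Ω ≃ₐ[k] Ω) (SuperellipticPic k Ω p f) ℓ φ) =
          (Fintype.card k : ℚ_[ℓ]) + 1 -
            Nat.card {P : PlaceOver Ω (SuperellipticFunctionField k Ω p f) // φ • P = P})
    (hdR : ∀ (K : Type) [Field K] [NumberField K] [IsCyclotomicExtension {3} ℚ K]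
      (f : ℤ[X]) (h4 : f.natDegree = 4) (hsep : (f.map (Int.castRingHom ℚ)).Separable)
      (v : HeightOneSpectrum (𝓞 K)) (hv : ((3 : ℕ) : 𝓞 K) ∈ v.asIdeal),
      haveI := fact_irreducible_superellipticPoly_picard K h4 hsep
      letI := (PAdicHodge.fontainePstAdicCompletion v 3 hv).algebra
      (PAdicHodge.fontainePstAdicCompletion v 3 hv).𝔅.IsAdmissible
        ((rationalTateGaloisRepOf (GeomPic K 3 (f.map (algebraMap ℤ K))) 3
          (picard_continuous_rationalTateRepresentation K f h4 hsep)).toLocal v)) :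
    picardCurve_exists_lambdaAdicRep_isDeRhamFramed :=
  picardCurve_exists_lambdaAdicRep_isDeRhamFramed_of_lefschetz_of_isDeRham
    (superelliptic_lefschetz_twisted_of_weil hW) hdR

/-- **`picardCurve_exists_lambdaAdicRep_isDeRhamFramed` from `deg = det` and the comparison theorem** (the de Rham
companion of `picardCurve_exists_lambdaAdicRep_of_degdet`; `hW := superelliptic_weil_of_degdet hD`).
[cite: Upton2009, Thm. 2.1 and §4] [cite: Faltings1989Crystalline, Ch. VIII Thm. 8.1]
[cite: MumfordAV1970, §19 Thm. 4, §21] [cite: Milne1986AbelianVarieties, Thm. 19.1] -/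
theorem picardCurve_exists_lambdaAdicRep_isDeRhamFramed_of_degdet_of_isDeRham
    (hD : ∀ (k : Type) [Field k] [Fintype k] (Ω : Type) [Field Ω] [Algebra k Ω] [IsAlgClosed Ω]
      [Algebra.IsAlgebraic k Ω] (p : ℕ) [Fact p.Prime] (ℓ : ℕ) [Fact ℓ.Prime] (f : k[X]),
      (p : k) ≠ 0 → (ℓ : k) ≠ 0 → f.Separable → ¬ p ∣ f.natDegree →
      ∀ [Fact (Irreducible (superellipticPoly k Ω p f))] (φ : Ω ≃ₐ[k] Ω), (∀ x : Ω, φ x = x ^ Fintype.card k) →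
        ∃ _ : Module.Finite ℚ_[ℓ] (RationalTateModule (SuperellipticPic k Ω p f) ℓ),
          ∀ r : ℕ, 0 < r →
            LinearMap.det (1 - rationalTateRepresentation (Ω ≃ₐ[k] Ω) (SuperellipticPic k Ω p f) ℓ φ ^ r) =
              (Nat.card {c : SuperellipticPic k Ω p f //
                SuperellipticPic.degree k Ω p f c = 0 ∧ (φ ^ r) • c = c} : ℚ_[ℓ]))
    (hdR : ∀ (K : Type) [Field K] [NumberField K] [IsCyclotomicExtension {3} ℚ K]
      (f : ℤ[X]) (h4 : f.natDegree = 4) (hsep : (f.map (Int.castRingHom ℚ)).Separable)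
      (v : HeightOneSpectrum (𝓞 K)) (hv : ((3 : ℕ) : 𝓞 K) ∈ v.asIdeal),
      haveI := fact_irreducible_superellipticPoly_picard K h4 hsep
      letI := (PAdicHodge.fontainePstAdicCompletion v 3 hv).algebra
      (PAdicHodge.fontainePstAdicCompletion v 3 hv).𝔅.IsAdmissible
        ((rationalTateGaloisRepOf (GeomPic K 3 (f.map (algebraMap ℤ K))) 3
          (picard_continuous_rationalTateRepresentation K f h4 hsep)).toLocal v)) :
    picardCurve_exists_lambdaAdicRep_isDeRhamFramed :=
  picardCurve_exists_lambdaAdicRep_isDeRhamFramed_of_weil_of_isDeRham (superelliptic_weil_of_degdet hD) hdR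

/-- **`picardCurve_exists_lambdaAdicRep_isDeRhamFramed` from a degree function with étale kernel counts and the
comparison theorem** — the de Rham companion of the tree's deepest door
`picardCurve_exists_lambdaAdicRep_of_degreeFunction_etale`, with the SAME finite-field input `hδ` (the theory of
the Jacobian of `y^p = f(x)` over finite fields as a degree function on `ℤ[φ]`: Mumford §19 Thm. 2, Thm. 4, §21;
Milne AV §12 Prop. 12.9, §19) and ONE further input, the de Rham comparison theorem `hdR` for the Tate modules of
the Picard curves at the places above `3` (Faltings 1989, Ch. VIII Thm. 8.1).  So the strengthened fact is now
reduced to exactly: `hδ` (shared with `picardCurve_exists_lambdaAdicRep`) and `hdR`.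
[cite: Upton2009, Thm. 2.1 and §4] [cite: Faltings1989Crystalline, Ch. VIII Thm. 8.1]
[cite: MumfordAV1970, §19 Thm. 2, Thm. 4, §21] [cite: Milne1986AbelianVarieties, §12 Prop. 12.9, §19 Thm. 19.1 (proof)] -/
theorem picardCurve_exists_lambdaAdicRep_isDeRhamFramed_of_degreeFunction_etale_of_isDeRham
    (hδ : ∀ (k : Type) [Field k] [Fintype k] (Ω : Type) [Field Ω] [Algebra k Ω] [IsAlgClosed Ω]
      [Algebra.IsAlgebraic k Ω] (p : ℕ) [Fact p.Prime] (ℓ : ℕ) [Fact ℓ.Prime] (f : k[X]),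
      (p : k) ≠ 0 → (ℓ : k) ≠ 0 → f.Separable → ¬ p ∣ f.natDegree →
      ∀ [Fact (Irreducible (superellipticPoly k Ω p f))] (φ : Ω ≃ₐ[k] Ω), (∀ x : Ω, φ x = x ^ Fintype.card k) →
        ∃ g : ℕ, (∀ n, Nat.card ((SuperellipticPic k Ω p f)[(ℓ ^ n : ℕ)]) = ℓ ^ (2 * g * n)) ∧
        ∃ (δ : ℤ[X] → ℤ) (P : ℤ[X]), (∀ F G : ℤ[X], δ (F * G) = δ F * δ G) ∧ P.Monic ∧
          (∀ m : ℤ, P.eval m = δ (X - C m)) ∧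
          (∀ e : ℕ, ∃ H : MvPolynomial (Fin e) ℚ, ∀ c : Fin e → ℤ,
            (δ (X ^ e + ∑ i : Fin e, C (c i) * X ^ (i : ℕ)) : ℚ) = MvPolynomial.eval (fun i => (c i : ℚ)) H) ∧
          (∀ F : ℤ[X], F.Monic → ((F.coeff 0 : ℤ) : k) ≠ 0 → δ F ≠ 0 →
            {a : SuperellipticPic k Ω p f | (∃ n : ℕ, ℓ ^ n • a = 0) ∧
                (aeval (DistribMulAction.toAddMonoidEnd (Ω ≃ₐ[k] Ω) (SuperellipticPic k Ω p f) φ) F :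
                  AddMonoid.End (SuperellipticPic k Ω p f)) a = 0}.Finite ∧
              Nat.card {a : SuperellipticPic k Ω p f | (∃ n : ℕ, ℓ ^ n • a = 0) ∧
                (aeval (DistribMulAction.toAddMonoidEnd (Ω ≃ₐ[k] Ω) (SuperellipticPic k Ω p f) φ) F :
                  AddMonoid.End (SuperellipticPic k Ω p f)) a = 0} = ℓ ^ padicValInt ℓ (δ F)) ∧
          (∀ r : ℕ, 0 < r → δ (X ^ r - 1) =
            Nat.card {c : SuperellipticPic k Ω p f //
              SuperellipticPic.degree k Ω p f c = 0 ∧ (φ ^ r) • c = c}))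
    (hdR : ∀ (K : Type) [Field K] [NumberField K] [IsCyclotomicExtension {3} ℚ K]
      (f : ℤ[X]) (h4 : f.natDegree = 4) (hsep : (f.map (Int.castRingHom ℚ)).Separable)
      (v : HeightOneSpectrum (𝓞 K)) (hv : ((3 : ℕ) : 𝓞 K) ∈ v.asIdeal),
      haveI := fact_irreducible_superellipticPoly_picard K h4 hsep
      letI := (PAdicHodge.fontainePstAdicCompletion v 3 hv).algebra
      (PAdicHodge.fontainePstAdicCompletion v 3 hv).𝔅.IsAdmissible
        ((rationalTateGaloisRepOf (GeomPic K 3 (f.map (algebraMap ℤ K))) 3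
          (picard_continuous_rationalTateRepresentation K f h4 hsep)).toLocal v)) :
    picardCurve_exists_lambdaAdicRep_isDeRhamFramed :=
  picardCurve_exists_lambdaAdicRep_isDeRhamFramed_of_degdet_of_isDeRham
    (superelliptic_degdet_of_degreeFunction_etale hδ) hdR

end DeuringWitness

end Literature.NumberTheory.GaloisRepresentations

end
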